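import Mathlib.NumberTheory.ModularForms.EisensteinSeries.E2.Transform
import Mathlib.NumberTheory.ModularForms.EisensteinSeries.Basic
import Mathlib.NumberTheory.ModularForms.CongruenceSubgroups
import Mathlib.NumberTheory.LSeries.HurwitzZetaValues
import HarnessLib

/-!
# Barrier (Schanuel) `NesterenkoModularScope`: the limit lemma and the behaviour of `E₂, E₄, E₆` under `SL₂(ℤ)` (toward Mahler's theorem) — proofs only

`Literature/Barriers/Schanuel/NesterenkoModularScopeMahlerLimit.lean` — proofs-only analytic
preliminaries for the proof of Mahler's theorem (`Mahler1969_ramanujan_algIndep`). No new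
definitions. Content:

* `eq_zero_of_sum_pow_mul_tendsto` — the limit lemma: if `Σ_{w ≤ W} J_r^w F_w(r) = 0` for all `r`,
  `‖J_r‖ → ∞` and `F_w(r) → L_w`, then `L_W = 0` (Mahler's device: divide by the highest power of
  `γ_r ω + δ_r` and let `r → ∞`);
* the transformation of `E₂, E₄, E₆` under `γ ∈ SL₂(ℤ)` in explicit form:
  `E₄(γτ) = (cτ+d)⁴E₄(τ)`, `E₆(γτ) = (cτ+d)⁶E₆(τ)`,
  `E₂(γτ) = (cτ+d)²E₂(τ) + K c (cτ+d)` with `K = −2πi/(2ζ(2)) ≠ 0` (Mathlib's `E2_slash_action`);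
* the matrices `γ_r = [[1, r], [n, 1 + rn]] ∈ SL₂(ℤ)`: `cτ + d = nτ + 1 + rn → ∞` and
  `γ_r τ → 1/n` as `r → ∞`; and `[[1, d − 1], [1, d]]` with `cτ + d = τ + d`.

## References

* [Mahler1969] K. Mahler, J. Austral. Math. Soc. 10 (1969) 445–450, proof of Theorem 1 ((1)–(8)).
* [NesterenkoPhilippon2001] LNM 1752 (2001), Ch. 1 §1 (1) and Proposition 1.1 iii).
-/

noncomputable section

open Filter Topology Complex UpperHalfPlane ModularForm EisensteinSeries ModularGroup
  CongruenceSubgroup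
open scoped Real MatrixGroups

namespace Literature.Barriers.Schanuel

/-! ### The limit lemma -/

/-- `‖J_r‖ → ∞` implies `J_r⁻¹ → 0`. [folklore] -/
theorem tendsto_inv_of_tendsto_norm_atTop {J : ℕ → ℂ}
    (hJ : Tendsto (fun r => ‖J r‖) atTop atTop) : Tendsto (fun r => (J r)⁻¹) atTop (𝓝 0) := by
  rw [tendsto_zero_iff_norm_tendsto_zero]
  simp only [norm_inv]
  exact hJ.inv_tendsto_atTop

/-- **The limit lemma**: if `Σ_{w ≤ W} J_r^w F_w(r) = 0` for every `r`, `‖J_r‖ → ∞`, and each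
`F_w(r)` converges to `L_w`, then `L_W = 0`.
[cite: Mahler1969, proof of Theorem 1 (division by `(γ_r ω + δ_r)^N` and `r → ∞`)] -/
theorem eq_zero_of_sum_pow_mul_tendsto {W : ℕ} {J : ℕ → ℂ}
    (hJ : Tendsto (fun r => ‖J r‖) atTop atTop) {F : ℕ → ℕ → ℂ} {L : ℕ → ℂ}
    (hF : ∀ w ≤ W, Tendsto (F w) atTop (𝓝 (L w)))
    (h : ∀ r, ∑ w ∈ Finset.range (W + 1), J r ^ w * F w r = 0) : L W = 0 := by
  have hinv := tendsto_inv_of_tendsto_norm_atTop hJ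
  have hne : ∀ᶠ r in atTop, J r ≠ 0 := by
    filter_upwards [hJ.eventually_ge_atTop 1] with r hr
    intro h0
    rw [h0, norm_zero] at hr
    exact absurd hr (by norm_num)
  set G : ℕ → ℂ := fun r => ∑ w ∈ Finset.range W, (J r)⁻¹ ^ (W - w) * F w r with hG
  have hFW : ∀ᶠ r in atTop, -G r = F W r := by
    filter_upwards [hne] with r hr
    have hr' := h r
    rw [Finset.sum_range_succ] at hr'
    have hJW : J r ^ W ≠ 0 := pow_ne_zero _ hr
    have e1 : J r ^ W * F W r = -∑ w ∈ Finset.range W, J r ^ w * F w r := by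
      linear_combination hr'
    have e2 : F W r = (J r ^ W)⁻¹ * (J r ^ W * F W r) := by
      rw [← mul_assoc, inv_mul_cancel₀ hJW, one_mul]
    rw [e2, e1, mul_neg, Finset.mul_sum, hG]
    congr 1
    refine Finset.sum_congr rfl fun w hw => ?_
    rw [Finset.mem_range] at hw
    rw [← mul_assoc]
    congr 1
    have hsplit : J r ^ W = J r ^ w * J r ^ (W - w) := by
      rw [← pow_add, Nat.add_sub_cancel' hw.le]
    rw [hsplit, mul_inv, inv_pow, mul_comm (J r ^ w)⁻¹, mul_assoc,
      inv_mul_cancel₀ (pow_ne_zero _ hr), mul_one]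
  have hG0 : Tendsto G atTop (𝓝 0) := by
    have hterm : ∀ w ∈ Finset.range W,
        Tendsto (fun r => (J r)⁻¹ ^ (W - w) * F w r) atTop (𝓝 0) := by
      intro w hw
      rw [Finset.mem_range] at hw
      have := (hinv.pow (W - w)).mul (hF w hw.le)
      rwa [zero_pow (Nat.sub_ne_zero_of_lt hw), zero_mul] at this
    have := tendsto_finsetSum (Finset.range W) hterm
    rw [Finset.sum_const_zero] at this
    exact this
  have hFW0 : Tendsto (F W) atTop (𝓝 0) := by
    have := hG0.neg
    rw [neg_zero] at this
    exact this.congr' hFW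
  exact tendsto_nhds_unique (hF W le_rfl) hFW0

/-! ### `E₂, E₄, E₆` under `SL₂(ℤ)` -/

/-- `E₄(γτ) = (cτ + d)⁴ E₄(τ)`. [folklore] -/
theorem E₄_slash_smul (γ : SL(2, ℤ)) (τ : ℍ) : E₄ (γ • τ) = (denom γ τ) ^ 4 * E₄ τ := by
  have : SlashInvariantFormClass (ModularForm 𝒮ℒ 4) Γ(1) 4 := Gamma_one_coe_eq_SL ▸ inferInstance
  have h := SlashInvariantForm.slash_action_eqn_SL'' (E₄ : ModularForm 𝒮ℒ 4) (mem_Gamma_one γ) τ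
  rw [h]
  norm_cast

/-- `E₆(γτ) = (cτ + d)⁶ E₆(τ)`. [folklore] -/
theorem E₆_slash_smul (γ : SL(2, ℤ)) (τ : ℍ) : E₆ (γ • τ) = (denom γ τ) ^ 6 * E₆ τ := by
  have : SlashInvariantFormClass (ModularForm 𝒮ℒ 6) Γ(1) 6 := Gamma_one_coe_eq_SL ▸ inferInstance
  have h := SlashInvariantForm.slash_action_eqn_SL'' (E₆ : ModularForm 𝒮ℒ 6) (mem_Gamma_one γ) τ
  rw [h]
  norm_cast

/-- **The anomaly of `E₂`**: `E₂(γτ) = (cτ + d)² E₂(τ) + K c (cτ + d)` with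
`K = −2πi/(2ζ(2))` (`= −6i/π`). [cite: NesterenkoPhilippon2001, Ch. 1 §1 (1) (p. 2)] -/
theorem E2_smul (γ : SL(2, ℤ)) (τ : ℍ) :
    E2 (γ • τ) = (denom γ τ) ^ 2 * E2 τ +
      (-(2 * π * Complex.I) / (2 * riemannZeta 2)) * ((γ 1 0 : ℤ) : ℂ) * denom γ τ := by
  have h := congrFun (E2_slash_action γ) τ
  rw [SL_slash_apply] at h
  simp only [Pi.sub_apply, Pi.smul_apply, smul_eq_mul, D2] at h
  have hd : denom γ τ ≠ 0 := denom_ne_zero γ τ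
  rw [zpow_neg, mul_inv_eq_iff_eq_mul₀ (zpow_ne_zero _ hd)] at h
  rw [h]
  have h2 : (denom (γ : GL (Fin 2) ℝ) τ) ^ (2 : ℤ) = (denom (γ : GL (Fin 2) ℝ) τ) ^ 2 := by
    norm_cast
  rw [h2]
  field_simp
  ring

/-- `K = −2πi/(2ζ(2)) ≠ 0`. [folklore] -/
theorem mahler_K_ne_zero : (-(2 * π * Complex.I) / (2 * riemannZeta 2) : ℂ) ≠ 0 := by
  have hζ : riemannZeta 2 ≠ 0 := by
    rw [riemannZeta_two]
    exact div_ne_zero (pow_ne_zero _ (ofReal_ne_zero.mpr Real.pi_ne_zero)) (by norm_num)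
  have hπ : (π : ℂ) ≠ 0 := ofReal_ne_zero.mpr Real.pi_ne_zero
  exact div_ne_zero (neg_ne_zero.mpr (mul_ne_zero (mul_ne_zero two_ne_zero hπ) I_ne_zero))
    (mul_ne_zero two_ne_zero hζ)

/-! ### The matrices `[[1, r], [n, 1 + rn]]` and `[[1, d − 1], [1, d]]` -/

/-- The elements `γ_r = [[1, r], [n, 1 + rn]]` of `SL₂(ℤ)`.
[cite: Mahler1969, proof of Theorem 1 (the sequences `Σ(θ)`, hypothesis (H₁))] -/
theorem exists_SL2Z_row (n r : ℤ) :
    ∃ γ : SL(2, ℤ), γ 0 0 = 1 ∧ γ 0 1 = r ∧ γ 1 0 = n ∧ γ 1 1 = 1 + r * n := by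
  refine ⟨⟨!![1, r; n, 1 + r * n], ?_⟩, ?_, ?_, ?_, ?_⟩
  · rw [Matrix.det_fin_two_of]; ring
  all_goals rfl

/-- `cτ + d` and `γτ` for a matrix with first column `(1, n)`. [folklore] -/
theorem denom_and_smul_of_entries {γ : SL(2, ℤ)} {n r : ℤ} (h00 : γ 0 0 = 1) (h01 : γ 0 1 = r)
    (h10 : γ 1 0 = n) (h11 : γ 1 1 = 1 + r * n) (τ : ℍ) :
    denom γ τ = (n : ℂ) * τ + (1 + r * n) ∧
      ((γ • τ : ℍ) : ℂ) = ((τ : ℂ) + r) / ((n : ℂ) * τ + (1 + r * n)) := by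
  constructor
  · rw [denom_apply]
    simp only [h10, h11]
    push_cast
    ring
  · rw [UpperHalfPlane.coe_specialLinearGroup_apply]
    simp only [h00, h01, h10, h11]
    push_cast
    simp

/-- For `n ≥ 1`: `‖nτ + 1 + rn‖ → ∞` as `r → ∞`. [folklore] -/
theorem tendsto_norm_denom_seq {n : ℕ} (hn : 1 ≤ n) (τ : ℍ) :
    Tendsto (fun r : ℕ => ‖(n : ℂ) * τ + (1 + (r : ℂ) * n)‖) atTop atTop := by
  have hre : ∀ r : ℕ, (n : ℝ) * (τ : ℂ).re + 1 + (r : ℝ) * n ≤ ‖(n : ℂ) * τ + (1 + (r : ℂ) * n)‖ := by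
    intro r
    refine le_trans (le_of_eq ?_) (re_le_norm _)
    simp
    ring
  refine tendsto_atTop_mono hre ?_
  have h1 : Tendsto (fun r : ℕ => (r : ℝ) * n) atTop atTop :=
    tendsto_natCast_atTop_atTop.atTop_mul_const (by exact_mod_cast hn)
  exact tendsto_atTop_add_const_left _ _ h1

/-- For `n ≥ 1`: `γ_r τ = (τ + r)/(nτ + 1 + rn) → 1/n` as `r → ∞`. [cite: Mahler1969, proof of Theorem 1 ((2): `α_r/γ_r → θ`)] -/
theorem tendsto_smul_seq {n : ℕ} (hn : 1 ≤ n) (τ : ℍ) :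
    Tendsto (fun r : ℕ => ((τ : ℂ) + r) / ((n : ℂ) * τ + (1 + (r : ℂ) * n))) atTop
      (𝓝 (1 / (n : ℂ))) := by
  have hn0 : (n : ℂ) ≠ 0 := by exact_mod_cast (by omega : n ≠ 0)
  have hJ := tendsto_norm_denom_seq hn τ
  have hne : ∀ᶠ r : ℕ in atTop, (n : ℂ) * τ + (1 + (r : ℂ) * n) ≠ 0 := by
    filter_upwards [hJ.eventually_ge_atTop 1] with r hr
    intro h0
    rw [h0, norm_zero] at hr
    exact absurd hr (by norm_num)
  have hinv := tendsto_inv_of_tendsto_norm_atTop hJ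
  have key : ∀ᶠ r : ℕ in atTop, 1 / (n : ℂ) - 1 / (n : ℂ) * ((n : ℂ) * τ + (1 + (r : ℂ) * n))⁻¹ =
      ((τ : ℂ) + r) / ((n : ℂ) * τ + (1 + (r : ℂ) * n)) := by
    filter_upwards [hne] with r hr
    set D : ℂ := (n : ℂ) * τ + (1 + (r : ℂ) * n) with hDdef
    have hτr : ((τ : ℂ) + r) = (n : ℂ)⁻¹ * (D - 1) := by
      rw [hDdef, eq_inv_mul_iff_mul_eq₀ hn0]
      ring
    rw [hτr, eq_div_iff hr]
    have hDD : D⁻¹ * D = 1 := inv_mul_cancel₀ hr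
    calc (1 / (n : ℂ) - 1 / (n : ℂ) * D⁻¹) * D = 1 / (n : ℂ) * D - 1 / (n : ℂ) * (D⁻¹ * D) := by
          ring
      _ = (n : ℂ)⁻¹ * (D - 1) := by rw [hDD]; ring
  have hlim : Tendsto (fun r : ℕ => 1 / (n : ℂ) - 1 / (n : ℂ) * ((n : ℂ) * τ + (1 + (r : ℂ) * n))⁻¹)
      atTop (𝓝 (1 / (n : ℂ))) := by
    have := (hinv.const_mul (1 / (n : ℂ))).const_sub (1 / (n : ℂ))
    rwa [mul_zero, sub_zero] at this
  exact hlim.congr' key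

end Literature.Barriers.Schanuel

end
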